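import Mathlib
import Summits.NavierStokesRegularity.NavierStokesRegularity.Theorems.LerayQuarterDissipationFiniteDissipationLiouvilleMicroscaleWindow
import Summits.NavierStokesRegularity.NavierStokesRegularity.Theorems.LerayQuarterDissipationFiniteDissipationLiouvilleSmallDissipationGap
import HarnessLib

/-!
# Crux `FiniteDissipationLiouville` (stmt-NavierStokesRegularity-22144): THE TAYLOR-MICROSCALE WINDOW
# with separate constants (Type-I constant `C`, envelope constant `A`) and the law's ceiling

Theorems file of route `LerayQuarterDissipation` (lead prover g18; `--supports` the crux; sequel of
`…MicroscaleWindow`). Navier–Stokes regularity is NOT proved by anything here; no summit is.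

`…MicroscaleWindow` states the window for `IsTypeIAncientMild C V ∧ HasTypeIDecay C V` (equal
constants, as the global budget `…CrossFlowDss.hasDerivAt_enstrophy_eq_neg_two_integral_slack`
requires). But the pricing `Str ≤ C√Z√D` uses only the TYPE-I constant; the envelope enters only
through integrability. The critical element of the crux has Type-I constant `C` (the crux's own)
and an envelope constant `A` that may be much larger, so the window must be stated with `C`:

* `integral_inner_lamb_le_typeI_sqrt'`, `deriv_enstrophy_le_sq'`, `window_of_deriv_nonneg'` — the
  budget `Z' ≤ ½(C²−1)Z − 2(√D − ½C√Z)²` and the window `(4D+Z)² ≤ 16C²ZD` at non-decreasing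
  instants, for `IsTypeIAncientMild C V` with ANY Type-I envelope `HasTypeIDecay A V`;
* **`exists_near_window_of_law`** — on the stratum `𝒟_{C,K}` with an envelope: in every
  similarity-time interval of length `L` some instant has
  `2(√D − ½C√Z)² ≤ ½(C²−1)Z + ‖curlCLM‖²·max K 0/L` (mean value theorem + the law's ceiling
  `Z ≤ ‖curlCLM‖²·max K 0`, `…SmallDissipationGap.integrable_sq_norm_lerayVorticity`) — the
  skeleton's clause: along the orbit of the hypothetical singular profile the vorticity Taylor
  microscale `λ = ‖ω‖₂/‖∇ω‖₂` recurs, up to `O(1/L)`, inside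
  `[2(C−√(C²−1))√(−t), 2(C+√(C²−1))√(−t)]` in every log-time window of length `L`.

HONEST FRAMING. Explicit necessary conditions on a HYPOTHETICAL object, in the time-recurrent sense;
the window comes from the crudest pricing `‖U‖ ≤ C` and is not claimed sharp; nothing is removed
from the catalogued DSS wall; verdict of the line unchanged (FRONTIER). Nothing here bears on
Navier–Stokes regularity.

References: Koch–Nadirashvili–Seregin–Šverák, Acta Math. 203 (2009) §4; Doering–Gibbon (1995)
§1.4; folklore energy method.
-/

noncomputable section

set_option linter.dupNamespace false

namespace Summit.NavierStokesRegularity.NavierStokesRegularity.Theorems.FiniteDissipationLiouville.MicroscaleWindow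

open MeasureTheory Set Filter Topology Metric InnerProductSpace Function Real
open scoped RealInnerProductSpace ContDiff
open Literature.Analysis Literature.Analysis.FluidPDE
open Summit.NavierStokesRegularity.NavierStokesRegularity.Theorems
open Summit.NavierStokesRegularity.NavierStokesRegularity.Theorems.GaussianGap
open Summit.NavierStokesRegularity.NavierStokesRegularity.Theorems.SimilarityEnstrophy
open Summit.NavierStokesRegularity.NavierStokesRegularity.Theorems.FiniteDissipationLiouville
open Summit.NavierStokesRegularity.NavierStokesRegularity.Theorems.FiniteDissipationLiouville.CrossFlow

variable {C : ℝ} {V : ℝ → EuclideanSpace ℝ (Fin 3) → EuclideanSpace ℝ (Fin 3)}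

/-! ### Separate constants -/

section Separate

variable {A : ℝ}

/-- `Str ≤ C√Z√D` with separate constants (`IsTypeIAncientMild C V`, `HasTypeIDecay A V`).
[folklore energy method] -/
theorem integral_inner_lamb_le_typeI_sqrt' (hV : IsTypeIAncientMild C V) (hdec : HasTypeIDecay A V)
    (s : ℝ) :
    ∫ y, ⟪lerayOrbit V s y, cross (lerayVorticity V s y) (curl (lerayVorticity V s) y)⟫ ≤
      C * (Real.sqrt (∫ y, ‖lerayVorticity V s y‖ ^ 2) *
        Real.sqrt (∫ y, ‖curl (lerayVorticity V s) y‖ ^ 2)) := by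
  have hV' : IsTypeIAncientMild (max C A) V := isTypeIAncientMild_of_le hV (le_max_left C A)
  have hdec' : HasTypeIDecay (max C A) V := hasTypeIDecay_of_le hdec (le_max_right C A)
  obtain ⟨C₁, C₂, C₃, hD1, hD2, -⟩ := IsTypeIAncientMild.gaugeBounds_of_hasTypeIDecay hV' hdec'
  have hC : 0 ≤ C := hV.nonneg
  have iC := integrable_norm_curl_lerayVorticity_sq hV' hD2 s
  have iZ := integrable_norm_lerayVorticity_sq hV' hD1 s
  have iΛ := integrable_inner_lerayOrbit_lamb hV' hD1 hD2 s
  have hΩinf := contDiff_lerayVorticity_slice hV s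
  have hΩc : Continuous (lerayVorticity V s) := hΩinf.continuous
  have hCc : Continuous (curl (lerayVorticity V s)) :=
    (contDiff_curl (n := 1) (hΩinf.of_le (by norm_cast))).continuous
  set f : EuclideanSpace ℝ (Fin 3) → ℝ := fun y => ‖lerayVorticity V s y‖ with hf
  set g : EuclideanSpace ℝ (Fin 3) → ℝ := fun y => ‖curl (lerayVorticity V s) y‖ with hg
  have hfc : Continuous f := hΩc.norm
  have hgc : Continuous g := hCc.norm
  have hfm : MemLp f (ENNReal.ofReal 2) volume := by
    rw [ENNReal.ofReal_ofNat]
    refine (memLp_two_iff_integrable_sq hfc.aestronglyMeasurable).2 ?_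
    exact iZ.congr (Eventually.of_forall fun y => by simp [hf])
  have hgm : MemLp g (ENNReal.ofReal 2) volume := by
    rw [ENNReal.ofReal_ofNat]
    refine (memLp_two_iff_integrable_sq hgc.aestronglyMeasurable).2 ?_
    exact iC.congr (Eventually.of_forall fun y => by simp [hg])
  have ifg : Integrable fun y => f y * g y := by
    refine Integrable.mono' ((iZ.add iC).div_const 2) (hfc.mul hgc).aestronglyMeasurable
      (Eventually.of_forall fun y => ?_)
    rw [Real.norm_of_nonneg (mul_nonneg (norm_nonneg _) (norm_nonneg _))]
    change ‖lerayVorticity V s y‖ * ‖curl (lerayVorticity V s) y‖ ≤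
      (‖lerayVorticity V s y‖ ^ 2 + ‖curl (lerayVorticity V s) y‖ ^ 2) / 2
    nlinarith [sq_nonneg (‖lerayVorticity V s y‖ - ‖curl (lerayVorticity V s) y‖)]
  have hCS : ∫ y, f y * g y ≤ Real.sqrt (∫ y, ‖lerayVorticity V s y‖ ^ 2) *
      Real.sqrt (∫ y, ‖curl (lerayVorticity V s) y‖ ^ 2) := by
    have h := integral_mul_le_Lp_mul_Lq_of_nonneg Real.HolderConjugate.two_two
      (Eventually.of_forall fun y => norm_nonneg _) (Eventually.of_forall fun y => norm_nonneg _)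
      hfm hgm
    have e1 : ∫ y, f y ^ (2 : ℝ) = ∫ y, ‖lerayVorticity V s y‖ ^ 2 :=
      integral_congr_ae (Eventually.of_forall fun y => by
        show ‖lerayVorticity V s y‖ ^ (2 : ℝ) = ‖lerayVorticity V s y‖ ^ 2
        rw [Real.rpow_two])
    have e2 : ∫ y, g y ^ (2 : ℝ) = ∫ y, ‖curl (lerayVorticity V s) y‖ ^ 2 :=
      integral_congr_ae (Eventually.of_forall fun y => by
        show ‖curl (lerayVorticity V s) y‖ ^ (2 : ℝ) = ‖curl (lerayVorticity V s) y‖ ^ 2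
        rw [Real.rpow_two])
    rw [e1, e2, ← Real.sqrt_eq_rpow, ← Real.sqrt_eq_rpow] at h
    exact h
  have hpt : ∀ y, ⟪lerayOrbit V s y, cross (lerayVorticity V s y) (curl (lerayVorticity V s) y)⟫ ≤
      C * (f y * g y) := by
    intro y
    calc ⟪lerayOrbit V s y, cross (lerayVorticity V s y) (curl (lerayVorticity V s) y)⟫
        ≤ ‖lerayOrbit V s y‖ * ‖cross (lerayVorticity V s y) (curl (lerayVorticity V s) y)‖ :=
          real_inner_le_norm _ _
      _ ≤ C * (f y * g y) := mul_le_mul (norm_lerayOrbit_le_of_typeI hV s y)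
          (norm_cross_le_norm_mul_norm _ _) (norm_nonneg _) hC
  calc ∫ y, ⟪lerayOrbit V s y, cross (lerayVorticity V s y) (curl (lerayVorticity V s) y)⟫
      ≤ ∫ y, C * (f y * g y) := integral_mono iΛ (ifg.const_mul C) hpt
    _ = C * ∫ y, f y * g y := integral_const_mul _ _
    _ ≤ _ := mul_le_mul_of_nonneg_left hCS hC

/-- **The budget with separate constants**: `Z'(s) ≤ ½(C²−1)Z − 2(√D − ½C√Z)²` for
`IsTypeIAncientMild C V` with any Type-I envelope `HasTypeIDecay A V`. [folklore energy method] -/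
theorem deriv_enstrophy_le_sq' (hV : IsTypeIAncientMild C V) (hdec : HasTypeIDecay A V) (s : ℝ) :
    deriv (fun σ => ∫ y, ‖lerayVorticity V σ y‖ ^ 2) s ≤
      (1 / 2) * (C ^ 2 - 1) * (∫ y, ‖lerayVorticity V s y‖ ^ 2) -
        2 * (Real.sqrt (∫ y, ‖curl (lerayVorticity V s) y‖ ^ 2) -
          (1 / 2) * C * Real.sqrt (∫ y, ‖lerayVorticity V s y‖ ^ 2)) ^ 2 := by
  have hV' : IsTypeIAncientMild (max C A) V := isTypeIAncientMild_of_le hV (le_max_left C A)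
  have hdec' : HasTypeIDecay (max C A) V := hasTypeIDecay_of_le hdec (le_max_right C A)
  obtain ⟨C₁, C₂, C₃, hD1, hD2, -⟩ := IsTypeIAncientMild.gaugeBounds_of_hasTypeIDecay hV' hdec'
  have hd := hasDerivAt_enstrophy_eq_neg_two_integral_slack hV' hdec' s
  rw [hd.deriv]
  have iC := integrable_norm_curl_lerayVorticity_sq hV' hD2 s
  have iZ := integrable_norm_lerayVorticity_sq hV' hD1 s
  have iΛ := integrable_inner_lerayOrbit_lamb hV' hD1 hD2 s
  have iZ' : Integrable fun y => (1 / 4 : ℝ) * ‖lerayVorticity V s y‖ ^ 2 := iZ.const_mul _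
  have iAB : Integrable fun y => ‖curl (lerayVorticity V s) y‖ ^ 2 +
      (1 / 4 : ℝ) * ‖lerayVorticity V s y‖ ^ 2 := iC.add iZ'
  have e : (∫ y, (‖curl (lerayVorticity V s) y‖ ^ 2 + (1 / 4) * ‖lerayVorticity V s y‖ ^ 2 -
      ⟪lerayOrbit V s y, cross (lerayVorticity V s y) (curl (lerayVorticity V s) y)⟫)) =
      (∫ y, ‖curl (lerayVorticity V s) y‖ ^ 2) + (1 / 4) * (∫ y, ‖lerayVorticity V s y‖ ^ 2) -
        ∫ y, ⟪lerayOrbit V s y, cross (lerayVorticity V s y) (curl (lerayVorticity V s) y)⟫ := by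
    rw [integral_sub iAB iΛ, integral_add iC iZ', integral_const_mul]
  rw [e]
  have h := integral_inner_lamb_le_typeI_sqrt' hV hdec s
  have hZ : 0 ≤ ∫ y, ‖lerayVorticity V s y‖ ^ 2 := integral_nonneg fun y => sq_nonneg _
  have hD : 0 ≤ ∫ y, ‖curl (lerayVorticity V s) y‖ ^ 2 := integral_nonneg fun y => sq_nonneg _
  have e1 := Real.sq_sqrt hZ
  have e2 := Real.sq_sqrt hD
  nlinarith

/-- **THE WINDOW with separate constants**: at a non-decreasing instant of the enstrophy,
`(4D + Z)² ≤ 16C²·Z·D` with the Type-I constant `C` (envelope constant arbitrary). [folklore] -/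
theorem window_of_deriv_nonneg' (hV : IsTypeIAncientMild C V) (hdec : HasTypeIDecay A V) {s : ℝ}
    (hs : 0 ≤ deriv (fun σ => ∫ y, ‖lerayVorticity V σ y‖ ^ 2) s) :
    (4 * (∫ y, ‖curl (lerayVorticity V s) y‖ ^ 2) + ∫ y, ‖lerayVorticity V s y‖ ^ 2) ^ 2 ≤
      16 * C ^ 2 * ((∫ y, ‖lerayVorticity V s y‖ ^ 2) * ∫ y, ‖curl (lerayVorticity V s) y‖ ^ 2) := by
  have h := deriv_enstrophy_le_sq' hV hdec s
  set Z : ℝ := ∫ y, ‖lerayVorticity V s y‖ ^ 2 with hZ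
  set D : ℝ := ∫ y, ‖curl (lerayVorticity V s) y‖ ^ 2 with hD
  have hZ0 : 0 ≤ Z := integral_nonneg fun y => sq_nonneg _
  have hD0 : 0 ≤ D := integral_nonneg fun y => sq_nonneg _
  have hC : 0 ≤ C := hV.nonneg
  have eZ := Real.sq_sqrt hZ0
  have eD := Real.sq_sqrt hD0
  have hsZ := Real.sqrt_nonneg Z
  have hsD := Real.sqrt_nonneg D
  have h1 : 4 * D + Z ≤ 4 * C * (Real.sqrt Z * Real.sqrt D) := by
    nlinarith [sq_nonneg (Real.sqrt D - (1 / 2) * C * Real.sqrt Z)]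
  have h2 : 0 ≤ 4 * D + Z := by linarith
  have h3 := mul_self_le_mul_self h2 h1
  have e : 4 * C * (Real.sqrt Z * Real.sqrt D) * (4 * C * (Real.sqrt Z * Real.sqrt D)) =
      16 * C ^ 2 * (Z * D) := by
    have : Real.sqrt Z * Real.sqrt D * (Real.sqrt Z * Real.sqrt D) = Z * D := by
      rw [show Real.sqrt Z * Real.sqrt D * (Real.sqrt Z * Real.sqrt D) =
        (Real.sqrt Z) ^ 2 * (Real.sqrt D) ^ 2 by ring, eZ, eD]
    calc 4 * C * (Real.sqrt Z * Real.sqrt D) * (4 * C * (Real.sqrt Z * Real.sqrt D))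
        = 16 * C ^ 2 * (Real.sqrt Z * Real.sqrt D * (Real.sqrt Z * Real.sqrt D)) := by ring
      _ = 16 * C ^ 2 * (Z * D) := by rw [this]
  rw [← sq, e] at h3
  exact h3

/-- **THE WINDOW RECURS, separate constants and the law's ceiling.** For a member of the stratum
`𝒟_{C,K}` with a Type-I envelope (any constant): in every similarity-time interval `[s₁, s₁ + L]`
some instant has `2(√D − ½C√Z)² ≤ ½(C²−1)Z + ‖curlCLM‖²·max K 0/L` (mean value theorem, `Z ≥ 0`,
and `Z ≤ ‖curlCLM‖²·max K 0` from the law, `…SmallDissipationGap.integrable_sq_norm_lerayVorticity`).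
In words: along the orbit of the hypothetical singular profile, up to an error `O(1/L)` uniform in
the position of the window, the vorticity Taylor microscale recurs inside
`[2(C−√(C²−1))√(−t), 2(C+√(C²−1))√(−t)]`. [folklore energy method] -/
theorem exists_near_window_of_law (hV : IsTypeIAncientMild C V) (hdec : HasTypeIDecay A V) {K : ℝ}
    (hK : ∀ t : ℝ, t < 0 → ∫⁻ x, ‖fderiv ℝ (V t) x‖ₑ ^ 2 ≤ ENNReal.ofReal (K / Real.sqrt (-t)))
    (s₁ : ℝ) {L : ℝ} (hL : 0 < L) :
    ∃ ξ ∈ Icc s₁ (s₁ + L),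
      2 * (Real.sqrt (∫ y, ‖curl (lerayVorticity V ξ) y‖ ^ 2) -
          (1 / 2) * C * Real.sqrt (∫ y, ‖lerayVorticity V ξ y‖ ^ 2)) ^ 2 ≤
        (1 / 2) * (C ^ 2 - 1) * (∫ y, ‖lerayVorticity V ξ y‖ ^ 2) +
          ‖curlCLM‖ ^ 2 * max K 0 / L := by
  have hV' : IsTypeIAncientMild (max C A) V := isTypeIAncientMild_of_le hV (le_max_left C A)
  have hdec' : HasTypeIDecay (max C A) V := hasTypeIDecay_of_le hdec (le_max_right C A)
  set Z : ℝ → ℝ := fun σ => ∫ y, ‖lerayVorticity V σ y‖ ^ 2 with hZdef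
  have hd := differentiable_enstrophy hV' hdec'
  have hlt : s₁ < s₁ + L := by linarith
  obtain ⟨ξ, hξ, hslope⟩ := exists_deriv_eq_slope Z hlt hd.continuous.continuousOn
    (hd.differentiableOn)
  refine ⟨ξ, Ioo_subset_Icc_self hξ, ?_⟩
  have hZL : 0 ≤ Z (s₁ + L) := integral_nonneg fun y => sq_nonneg _
  have hZ1 : Z s₁ ≤ ‖curlCLM‖ ^ 2 * max K 0 :=
    (SmallDissipationGap.integrable_sq_norm_lerayVorticity hV hK s₁).2
  have hlow : -(‖curlCLM‖ ^ 2 * max K 0 / L) ≤ deriv Z ξ := by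
    rw [hslope, show s₁ + L - s₁ = L by ring]
    have : -(‖curlCLM‖ ^ 2 * max K 0 / L) ≤ (0 - Z s₁) / L := by
      rw [show -(‖curlCLM‖ ^ 2 * max K 0 / L) = (-(‖curlCLM‖ ^ 2 * max K 0)) / L by ring]
      exact div_le_div_of_nonneg_right (by linarith) hL.le
    exact this.trans (div_le_div_of_nonneg_right (by linarith) hL.le)
  have hsq := deriv_enstrophy_le_sq' hV hdec ξ
  have : deriv Z ξ = deriv (fun σ => ∫ y, ‖lerayVorticity V σ y‖ ^ 2) ξ := rfl
  rw [this] at hlow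
  show 2 * (Real.sqrt (∫ y, ‖curl (lerayVorticity V ξ) y‖ ^ 2) -
      (1 / 2) * C * Real.sqrt (∫ y, ‖lerayVorticity V ξ y‖ ^ 2)) ^ 2 ≤
    (1 / 2) * (C ^ 2 - 1) * (∫ y, ‖lerayVorticity V ξ y‖ ^ 2) + ‖curlCLM‖ ^ 2 * max K 0 / L
  linarith

end Separate

end Summit.NavierStokesRegularity.NavierStokesRegularity.Theorems.FiniteDissipationLiouville.MicroscaleWindow

end
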